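import Mathlib
import Literature.NumberTheory.EllipticCurves.ModularCurveKleinJ
import Literature.NumberTheory.ModularForms.QExpansionAlgebra
import Summits.Langlands.Langlands.Theorems.CapacityClassicalityCongruenceToClassicalQuotient

/-!
# Analytic packaging for the line `Sketch` of `IntegralOverconvergentIsCongruence`

Stub `stub_analyticPackaging` of crux item stmt-Langlands-8457 (route CapacityClassicality).
For complex coefficients `b` of radius `≥ 1`:

* the `q`-series `g(τ) = Σ bₙ qⁿ` (`q = e^{2πiτ}`) is holomorphic and `1`-periodic on `ℍ`, is the
  sum of its series, and `qExpansion 1 g = Σ bₙ qⁿ`;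
* `y := g¹² / Δᵏ` (`k : ℤ`) is holomorphic and `1`-periodic;
* the `q`-expansion coefficients of `E₄³` and `Δ` have radius `≥ 1`;
* an identity of formal `q`-series `Σ c_{ij} X₁ⁱ X₂^{D₁-i} (G¹²X₂^{k⁻})ʲ (X₂^{k⁺})^{D₂-j} = 0`
  (`X₁ = qExp(E₄)³`, `X₂ = qExp(Δ)`, `G = Σ bₙ qⁿ`) yields the identity of functions
  `Σ c_{ij} j(τ)ⁱ y(τ)ʲ = 0` on `ℍ` (`j = E₄³/Δ = kleinJ`).

Everything is elementary: absolutely convergent power series on the unit disc, Mathlib's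
`qExpansion` API, and the `q`-expansion algebra of "nice" (periodic, holomorphic, bounded at
`i∞`) functions of `Literature/NumberTheory/ModularForms/QExpansionAlgebra`.
-/

set_option linter.dupNamespace false -- project-wide option (lakefile weak.linter.dupNamespace); `Summit.Langlands.Langlands` is the mandated namespace

open scoped MatrixGroups Manifold Topology
open UpperHalfPlane CongruenceSubgroup Metric PowerSeries
open Literature.NumberTheory.Automorphic
open Literature.NumberTheory.EllipticCurves Literature.NumberTheory.EllipticCurves.ModularForms

noncomputable section

namespace Summit.Langlands.Langlands.Theorems.CapacityClassicality

open Literature.NumberTheory.ModularForms.QExpansionAlgebra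
open Literature.NumberTheory.Automorphic.ModularLambda (qExpansion_coeff_eq_of_hasSum)

/-! ## `q`-series of radius `≥ 1` -/

/-- A `q`-series whose coefficients have radius `≥ 1` is holomorphic on the unit disc. -/
private theorem differentiableOn_qSeries {b : ℕ → ℂ}
    (hb : ∀ t : ℝ, 0 < t → t < 1 → ∃ K : ℝ, ∀ n, ‖b n‖ * t ^ n ≤ K) :
    DifferentiableOn ℂ (fun q : ℂ ↦ ∑' n : ℕ, b n * q ^ n) (Metric.ball 0 1) := by
  intro w hw
  rw [Metric.mem_ball, dist_zero_right] at hw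
  set r : ℝ := (‖w‖ + 1) / 2 with hr
  have hr0 : 0 < r := by positivity
  have hwr : ‖w‖ < r := by rw [hr]; linarith
  have hrn : ‖(r : ℂ)‖ < 1 := by rw [Complex.norm_of_nonneg hr0.le, hr]; linarith
  have hdiff : DifferentiableOn ℂ (fun q : ℂ ↦ ∑' n : ℕ, b n * q ^ n) (Metric.ball 0 r) :=
    Complex.differentiableOn_tsum_of_summable_norm (F := fun (n : ℕ) (q : ℂ) ↦ b n * q ^ n)
      (summable_norm_mul_pow_of_bound hb hrn) (fun n ↦ by fun_prop) Metric.isOpen_ball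
      (fun n z hz ↦ by
        rw [Metric.mem_ball, dist_zero_right] at hz
        rw [norm_mul, norm_mul, norm_pow, norm_pow, Complex.norm_of_nonneg hr0.le]
        exact mul_le_mul_of_nonneg_left (pow_le_pow_left₀ (norm_nonneg _) hz.le n)
          (norm_nonneg _))
  exact (hdiff.differentiableAt (Metric.isOpen_ball.mem_nhds (by simpa using hwr)))
    |>.differentiableWithinAt

/-- `𝕢(τ + 1) = 𝕢(τ)` for the period-`1` parameter `𝕢 = e^{2πiτ}`. -/
private theorem qParam_vadd_one (τ : ℍ) :
    Function.Periodic.qParam 1 (((1 : ℝ) +ᵥ τ : ℍ) : ℂ) = Function.Periodic.qParam 1 (τ : ℂ) := by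
  rw [coe_vadd]
  simp only [Function.Periodic.qParam, Complex.ofReal_one, div_one, mul_add, mul_one,
    Complex.exp_add, Complex.exp_two_pi_mul_I, one_mul]

/-- **The `q`-series of a sequence of radius `≥ 1` is a nice function on `ℍ`**: it is
`1`-periodic, holomorphic and bounded at `i∞`, it is the sum of its series at every point, and
its `qExpansion 1` is the series itself. -/
private theorem qSeries_nice {b : ℕ → ℂ}
    (hb : ∀ t : ℝ, 0 < t → t < 1 → ∃ K : ℝ, ∀ n, ‖b n‖ * t ^ n ≤ K) :
    (Function.Periodic ((fun τ : ℍ ↦ ∑' n : ℕ, b n * Function.Periodic.qParam 1 (τ : ℂ) ^ n) ∘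
        ofComplex) ((1 : ℝ) : ℂ) ∧
      MDiff (fun τ : ℍ ↦ ∑' n : ℕ, b n * Function.Periodic.qParam 1 (τ : ℂ) ^ n) ∧
      IsBoundedAtImInfty (fun τ : ℍ ↦ ∑' n : ℕ, b n * Function.Periodic.qParam 1 (τ : ℂ) ^ n)) ∧
    (∀ τ : ℍ, HasSum (fun n : ℕ ↦ b n * Function.Periodic.qParam 1 (τ : ℂ) ^ n)
        (∑' n : ℕ, b n * Function.Periodic.qParam 1 (τ : ℂ) ^ n)) ∧
    qExpansion 1 (fun τ : ℍ ↦ ∑' n : ℕ, b n * Function.Periodic.qParam 1 (τ : ℂ) ^ n) =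
      PowerSeries.mk b := by
  obtain ⟨hnice, -, -⟩ := nice_comp_qParam (𝒴 := fun q : ℂ ↦ ∑' n : ℕ, b n * q ^ n)
    (differentiableOn_qSeries hb) one_pos
  have hsum : ∀ τ : ℍ, HasSum (fun n : ℕ ↦ b n * Function.Periodic.qParam 1 (τ : ℂ) ^ n)
      (∑' n : ℕ, b n * Function.Periodic.qParam 1 (τ : ℂ) ^ n) := fun τ ↦
    (summable_norm_mul_pow_of_bound hb
      (Function.Periodic.norm_qParam_lt_one one_pos τ.im_pos)).of_norm.hasSum
  refine ⟨hnice, hsum, ?_⟩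
  ext n
  rw [PowerSeries.coeff_mk]
  exact qExpansion_coeff_eq_of_hasSum one_pos
    (analyticAt_cuspFunction_zero one_pos hnice.1 hnice.2.1 hnice.2.2)
    (fun τ ↦ by simpa only [smul_eq_mul] using hsum τ) n

/-! ## Coefficients of nice functions have radius `≥ 1` -/

/-- The `q`-expansion coefficients `aₙ` of a nice function satisfy `‖aₙ‖ tⁿ ≤ K` for every
`0 < t < 1`. -/
private theorem coeff_bound_of_nice {f : ℍ → ℂ} {h : ℝ} (hh : 0 < h)
    (hf : Function.Periodic (f ∘ ofComplex) h ∧ MDiff f ∧ IsBoundedAtImInfty f)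
    (t : ℝ) (ht0 : 0 < t) (ht1 : t < 1) :
    ∃ K : ℝ, ∀ n, ‖coeff n (qExpansion h f)‖ * t ^ n ≤ K := by
  have hq : ‖(t : ℂ)‖ < 1 := by rwa [Complex.norm_of_nonneg ht0.le]
  have hs := (hasSum_qExpansion_of_norm_lt hh hf.1 hf.2.1 hf.2.2 hq).summable.norm
  have hs' : Summable fun m ↦ ‖coeff m (qExpansion h f)‖ * t ^ m := by
    refine hs.congr fun m ↦ ?_
    rw [smul_eq_mul, norm_mul, norm_pow, Complex.norm_of_nonneg ht0.le]
  exact ⟨∑' m, ‖coeff m (qExpansion h f)‖ * t ^ m, fun n ↦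
    hs'.le_tsum n fun m _ ↦ by positivity⟩

/-! ## The level-one forms `E₄` and `Δ` -/

/-- `E₄` is nice of period `1`. -/
private theorem nice_E₄ :
    Function.Periodic ((⇑ModularForm.E₄ : ℍ → ℂ) ∘ ofComplex) ((1 : ℝ) : ℂ) ∧
      MDiff (⇑ModularForm.E₄ : ℍ → ℂ) ∧ IsBoundedAtImInfty (⇑ModularForm.E₄ : ℍ → ℂ) :=
  ⟨SlashInvariantFormClass.periodic_comp_ofComplex _ one_mem_strictPeriods_SL,
    ModularFormClass.holo _, ModularFormClass.bdd_at_infty _⟩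

/-- `Δ` is nice of period `1`. -/
private theorem nice_discriminant :
    Function.Periodic ((⇑CuspForm.discriminant : ℍ → ℂ) ∘ ofComplex) ((1 : ℝ) : ℂ) ∧
      MDiff (⇑CuspForm.discriminant : ℍ → ℂ) ∧
      IsBoundedAtImInfty (⇑CuspForm.discriminant : ℍ → ℂ) :=
  ⟨SlashInvariantFormClass.periodic_comp_ofComplex _ one_mem_strictPeriods_SL,
    ModularFormClass.holo _, ModularFormClass.bdd_at_infty _⟩

/-- `Δ(τ + 1) = Δ(τ)`. -/
private theorem discriminant_vadd_one (τ : ℍ) :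
    ModularForm.discriminant ((1 : ℝ) +ᵥ τ) = ModularForm.discriminant τ :=
  SlashInvariantForm.vAdd_apply_of_mem_strictPeriods CuspForm.discriminant τ
    one_mem_strictPeriods_SL

/-- `G¹² / Δᵏ` is holomorphic for holomorphic `G` and `k : ℤ`. -/
private theorem mdifferentiable_pow_div_zpow {G : ℍ → ℂ} (hG : MDiff G) (k : ℤ) :
    MDiff (fun τ : ℍ ↦ G τ ^ 12 / ModularForm.discriminant τ ^ k) := by
  have hΔ : MDiff (ModularForm.discriminant : ℍ → ℂ) := CuspForm.discriminant.holo'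
  rw [UpperHalfPlane.mdifferentiable_iff] at hG hΔ ⊢
  change DifferentiableOn ℂ (fun z : ℂ ↦ (G ∘ ofComplex) z ^ 12 /
    (ModularForm.discriminant ∘ ofComplex) z ^ k) {z : ℂ | 0 < z.im}
  exact (hG.fun_pow 12).fun_div
    (hΔ.zpow (Or.inl fun z _ ↦ ModularForm.discriminant_ne_zero _))
    fun z _ ↦ zpow_ne_zero _ (ModularForm.discriminant_ne_zero _)

/-- `Δ(τ)ᵏ = Δ(τ)^{k⁺} / Δ(τ)^{k⁻}` for `k : ℤ`. -/
private theorem discriminant_zpow_eq (τ : ℍ) (k : ℤ) :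
    ModularForm.discriminant τ ^ k =
      ModularForm.discriminant τ ^ k.toNat / ModularForm.discriminant τ ^ (-k).toNat := by
  rw [← zpow_natCast, ← zpow_natCast, ← zpow_sub₀ (ModularForm.discriminant_ne_zero τ),
    Int.toNat_sub_toNat_neg]

/-! ## The auxiliary combinations and their `q`-expansions -/

/-- The summands `c · X₁ⁱ X₂ᵃ (G¹² X₂^{k₂})ʲ (X₂^{k₁})ᵈ` of the auxiliary function are nice. -/
private theorem nice_term {F₁ F₂ G : ℍ → ℂ} {H : ℝ}
    (hF₁ : Function.Periodic (F₁ ∘ ofComplex) H ∧ MDiff F₁ ∧ IsBoundedAtImInfty F₁)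
    (hF₂ : Function.Periodic (F₂ ∘ ofComplex) H ∧ MDiff F₂ ∧ IsBoundedAtImInfty F₂)
    (hG : Function.Periodic (G ∘ ofComplex) H ∧ MDiff G ∧ IsBoundedAtImInfty G)
    (c : ℂ) (i a j d k₁ k₂ : ℕ) :
    Function.Periodic (((fun _ : ℍ ↦ c) * (F₁ ^ 3) ^ i * F₂ ^ a * (G ^ 12 * F₂ ^ k₂) ^ j *
        (F₂ ^ k₁) ^ d) ∘ ofComplex) H ∧
      MDiff ((fun _ : ℍ ↦ c) * (F₁ ^ 3) ^ i * F₂ ^ a * (G ^ 12 * F₂ ^ k₂) ^ j *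
        (F₂ ^ k₁) ^ d) ∧
      IsBoundedAtImInfty ((fun _ : ℍ ↦ c) * (F₁ ^ 3) ^ i * F₂ ^ a * (G ^ 12 * F₂ ^ k₂) ^ j *
        (F₂ ^ k₁) ^ d) :=
  nice_mul (nice_mul (nice_mul (nice_mul (nice_const c H) (nice_pow (nice_pow hF₁ 3) i))
    (nice_pow hF₂ a)) (nice_pow (nice_mul (nice_pow hG 12) (nice_pow hF₂ k₂)) j))
    (nice_pow (nice_pow hF₂ k₁) d)

/-- The `q`-expansion of a summand of the auxiliary function. -/
private theorem qExpansion_term {F₁ F₂ G : ℍ → ℂ} {H : ℝ} (hH : 0 < H)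
    (hF₁ : Function.Periodic (F₁ ∘ ofComplex) H ∧ MDiff F₁ ∧ IsBoundedAtImInfty F₁)
    (hF₂ : Function.Periodic (F₂ ∘ ofComplex) H ∧ MDiff F₂ ∧ IsBoundedAtImInfty F₂)
    (hG : Function.Periodic (G ∘ ofComplex) H ∧ MDiff G ∧ IsBoundedAtImInfty G)
    {P : PowerSeries ℂ} (hGq : qExpansion H G = P) (c : ℂ) (i a j d k₁ k₂ : ℕ) :
    qExpansion H ((fun _ : ℍ ↦ c) * (F₁ ^ 3) ^ i * F₂ ^ a * (G ^ 12 * F₂ ^ k₂) ^ j *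
        (F₂ ^ k₁) ^ d) =
      PowerSeries.C c * ((qExpansion H F₁) ^ 3) ^ i * (qExpansion H F₂) ^ a *
        (P ^ 12 * (qExpansion H F₂) ^ k₂) ^ j * ((qExpansion H F₂) ^ k₁) ^ d := by
  rw [qExpansion_mul_of_nice hH (nice_mul (nice_mul (nice_mul (nice_const c H)
      (nice_pow (nice_pow hF₁ 3) i)) (nice_pow hF₂ a))
      (nice_pow (nice_mul (nice_pow hG 12) (nice_pow hF₂ k₂)) j)) (nice_pow (nice_pow hF₂ k₁) d),
    qExpansion_mul_of_nice hH (nice_mul (nice_mul (nice_const c H) (nice_pow (nice_pow hF₁ 3) i))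
      (nice_pow hF₂ a)) (nice_pow (nice_mul (nice_pow hG 12) (nice_pow hF₂ k₂)) j),
    qExpansion_mul_of_nice hH (nice_mul (nice_const c H) (nice_pow (nice_pow hF₁ 3) i))
      (nice_pow hF₂ a),
    qExpansion_mul_of_nice hH (nice_const c H) (nice_pow (nice_pow hF₁ 3) i),
    qExpansion_const c hH,
    qExpansion_pow_of_nice hH (nice_pow hF₁ 3) i, qExpansion_pow_of_nice hH hF₁ 3,
    qExpansion_pow_of_nice hH hF₂ a,
    qExpansion_pow_of_nice hH (nice_mul (nice_pow hG 12) (nice_pow hF₂ k₂)) j,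
    qExpansion_mul_of_nice hH (nice_pow hG 12) (nice_pow hF₂ k₂),
    qExpansion_pow_of_nice hH hG 12, hGq, qExpansion_pow_of_nice hH hF₂ k₂,
    qExpansion_pow_of_nice hH (nice_pow hF₂ k₁) d, qExpansion_pow_of_nice hH hF₂ k₁]

/-- **Transfer of the `q`-series identity to `ℍ`.** If `G` is nice of period `1` with
`qExpansion 1 G = Σ bₙ qⁿ` and the formal combination
`Σ c_{ij} X₁ⁱ X₂^{D₁-i} (B¹² X₂^{k⁻})ʲ (X₂^{k⁺})^{D₂-j}` (`X₁ = qExp(E₄)³`, `X₂ = qExp(Δ)`,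
`B = Σ bₙ qⁿ`) vanishes, then `Σ c_{ij} j(τ)ⁱ (G(τ)¹²/Δ(τ)ᵏ)ʲ = 0` on `ℍ`. -/
private theorem transfer {G : ℍ → ℂ} {b : ℕ → ℂ} (k : ℤ)
    (hG : Function.Periodic (G ∘ ofComplex) ((1 : ℝ) : ℂ) ∧ MDiff G ∧ IsBoundedAtImInfty G)
    (hGq : qExpansion 1 G = PowerSeries.mk b)
    (D₁ D₂ : ℕ) (c : Fin (D₁ + 1) → Fin (D₂ + 1) → ℂ)
    (hc : (∑ i : Fin (D₁ + 1), ∑ j : Fin (D₂ + 1),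
      PowerSeries.C (c i j) * ((qExpansion 1 ⇑ModularForm.E₄) ^ 3) ^ (i : ℕ) *
        (qExpansion 1 ⇑CuspForm.discriminant) ^ (D₁ - i) *
        ((PowerSeries.mk b) ^ 12 * (qExpansion 1 ⇑CuspForm.discriminant) ^ (-k).toNat) ^ (j : ℕ) *
        ((qExpansion 1 ⇑CuspForm.discriminant) ^ k.toNat) ^ (D₂ - j)) = 0)
    (τ : ℍ) :
    ∑ i : Fin (D₁ + 1), ∑ j : Fin (D₂ + 1),
      c i j * kleinJ τ ^ (i : ℕ) * (G τ ^ 12 / ModularForm.discriminant τ ^ k) ^ (j : ℕ) = 0 := by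
  -- the auxiliary function
  set Φ : ℍ → ℂ := ∑ i : Fin (D₁ + 1), ∑ j : Fin (D₂ + 1),
    ((fun _ : ℍ ↦ c i j) * ((⇑ModularForm.E₄ : ℍ → ℂ) ^ 3) ^ (i : ℕ) *
      (⇑CuspForm.discriminant : ℍ → ℂ) ^ (D₁ - i) *
      (G ^ 12 * (⇑CuspForm.discriminant : ℍ → ℂ) ^ (-k).toNat) ^ (j : ℕ) *
      ((⇑CuspForm.discriminant : ℍ → ℂ) ^ k.toNat) ^ (D₂ - j)) with hΦdef
  have hΦn : Function.Periodic (Φ ∘ ofComplex) ((1 : ℝ) : ℂ) ∧ MDiff Φ ∧ IsBoundedAtImInfty Φ :=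
    nice_sum _ fun i _ ↦ nice_sum _ fun j _ ↦
      nice_term nice_E₄ nice_discriminant hG _ _ _ _ _ _ _
  have hΦq : qExpansion 1 Φ = 0 := by
    rw [← hc, hΦdef, qExpansion_sum_of_nice _ one_pos (fun i _ ↦ nice_sum _ fun j _ ↦
      nice_term nice_E₄ nice_discriminant hG _ _ _ _ _ _ _)]
    refine Finset.sum_congr rfl fun i _ ↦ ?_
    rw [qExpansion_sum_of_nice _ one_pos (fun j _ ↦
      nice_term nice_E₄ nice_discriminant hG _ _ _ _ _ _ _)]
    refine Finset.sum_congr rfl fun j _ ↦ ?_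
    exact qExpansion_term one_pos nice_E₄ nice_discriminant hG hGq _ _ _ _ _ _ _
  have hΦ0 : Φ = 0 := (qExpansion_eq_zero_iff one_pos hΦn.1 hΦn.2.1 hΦn.2.2).mp hΦq
  -- evaluate at `τ`
  have hd : ModularForm.discriminant τ ≠ 0 := ModularForm.discriminant_ne_zero τ
  have hΦτ : Φ τ = (ModularForm.discriminant τ ^ D₁ * (ModularForm.discriminant τ ^ k.toNat) ^ D₂) *
      ∑ i : Fin (D₁ + 1), ∑ j : Fin (D₂ + 1),
        c i j * kleinJ τ ^ (i : ℕ) * (G τ ^ 12 / ModularForm.discriminant τ ^ k) ^ (j : ℕ) := by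
    rw [hΦdef, Finset.sum_apply, Finset.mul_sum]
    refine Finset.sum_congr rfl fun i _ ↦ ?_
    rw [Finset.sum_apply, Finset.mul_sum]
    refine Finset.sum_congr rfl fun j _ ↦ ?_
    simp only [Pi.mul_apply, Pi.pow_apply, CuspForm.coe_discriminant]
    have h1 : ModularForm.discriminant τ ^ D₁ =
        ModularForm.discriminant τ ^ (i : ℕ) * ModularForm.discriminant τ ^ (D₁ - i) := by
      rw [← pow_add, Nat.add_sub_cancel' (Fin.is_le i)]
    have h2 : (ModularForm.discriminant τ ^ k.toNat) ^ D₂ =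
        (ModularForm.discriminant τ ^ k.toNat) ^ (j : ℕ) *
          (ModularForm.discriminant τ ^ k.toNat) ^ (D₂ - j) := by
      rw [← pow_add, Nat.add_sub_cancel' (Fin.is_le j)]
    have hP : (ModularForm.discriminant τ ^ k.toNat) ^ (j : ℕ) ≠ 0 :=
      pow_ne_zero _ (pow_ne_zero _ hd)
    rw [E₄_cube_eq_kleinJ_mul, discriminant_zpow_eq, h1, h2, div_div_eq_mul_div, div_pow, mul_pow]
    field_simp
  have h0 : Φ τ = 0 := by rw [hΦ0]; rfl
  rw [hΦτ] at h0
  exact (mul_eq_zero.mp h0).resolve_left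
    (mul_ne_zero (pow_ne_zero _ hd) (pow_ne_zero _ (pow_ne_zero _ hd)))

/-! ## The stub -/

/-- **Analytic packaging.** For complex coefficients `b` of radius `≥ 1`, the q-series
`g(τ) = Σ bₙ qⁿ` is holomorphic and `1`-periodic on `ℍ` with `qExpansion 1 g = Σ bₙ qⁿ`;
`y := g¹²/Δᵏ` is holomorphic and `1`-periodic; the q-expansions of `E₄³` and `Δ` have radius
`≥ 1`; and a q-SERIES identity `Σ c_{ij} X₁ⁱ X₂^{D₁-i} (G¹²X₂^{k⁻})ʲ (X₂^{k⁺})^{D₂-j} = 0`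
(`X₁ = qExp(E₄)³`, `X₂ = qExp(Δ)`, `G = Σ bₙqⁿ`) becomes the FUNCTION identity
`Σ c_{ij} j(τ)ⁱ y(τ)ʲ = 0` on `ℍ` (`j = E₄³/Δ = kleinJ`). -/
theorem stub_analyticPackaging (b : ℕ → ℂ)
    (hb : ∀ t : ℝ, 0 < t → t < 1 → ∃ K : ℝ, ∀ n, ‖b n‖ * t ^ n ≤ K) (k : ℤ) :
    MDifferentiable 𝓘(ℂ, ℂ) 𝓘(ℂ, ℂ)
        (fun τ : ℍ ↦ ∑' n : ℕ, b n * Function.Periodic.qParam 1 (τ : ℂ) ^ n) ∧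
      (∀ τ : ℍ, (∑' n : ℕ, b n * Function.Periodic.qParam 1 (((1 : ℝ) +ᵥ τ : ℍ) : ℂ) ^ n) =
        ∑' n : ℕ, b n * Function.Periodic.qParam 1 (τ : ℂ) ^ n) ∧
      (∀ τ : ℍ, HasSum (fun n : ℕ ↦ b n * Function.Periodic.qParam 1 (τ : ℂ) ^ n)
        (∑' n : ℕ, b n * Function.Periodic.qParam 1 (τ : ℂ) ^ n)) ∧
      qExpansion 1 (fun τ : ℍ ↦ ∑' n : ℕ, b n * Function.Periodic.qParam 1 (τ : ℂ) ^ n) =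
        PowerSeries.mk b ∧
      MDifferentiable 𝓘(ℂ, ℂ) 𝓘(ℂ, ℂ)
        (fun τ : ℍ ↦ (∑' n : ℕ, b n * Function.Periodic.qParam 1 (τ : ℂ) ^ n) ^ 12 /
          ModularForm.discriminant τ ^ k) ∧
      (∀ τ : ℍ, (∑' n : ℕ, b n * Function.Periodic.qParam 1 (((1 : ℝ) +ᵥ τ : ℍ) : ℂ) ^ n) ^ 12 /
          ModularForm.discriminant ((1 : ℝ) +ᵥ τ) ^ k =
        (∑' n : ℕ, b n * Function.Periodic.qParam 1 (τ : ℂ) ^ n) ^ 12 /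
          ModularForm.discriminant τ ^ k) ∧
      (∀ t : ℝ, 0 < t → t < 1 → ∃ K : ℝ, ∀ n,
        ‖coeff n ((qExpansion 1 ⇑ModularForm.E₄) ^ 3)‖ * t ^ n ≤ K) ∧
      (∀ t : ℝ, 0 < t → t < 1 → ∃ K : ℝ, ∀ n,
        ‖coeff n (qExpansion 1 ⇑CuspForm.discriminant)‖ * t ^ n ≤ K) ∧
      ∀ (D₁ D₂ : ℕ) (c : Fin (D₁ + 1) → Fin (D₂ + 1) → ℂ),
        (∑ i : Fin (D₁ + 1), ∑ j : Fin (D₂ + 1),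
          PowerSeries.C (c i j) * ((qExpansion 1 ⇑ModularForm.E₄) ^ 3) ^ (i : ℕ) *
            (qExpansion 1 ⇑CuspForm.discriminant) ^ (D₁ - i) *
            ((PowerSeries.mk b) ^ 12 * (qExpansion 1 ⇑CuspForm.discriminant) ^ (-k).toNat) ^ (j : ℕ) *
            ((qExpansion 1 ⇑CuspForm.discriminant) ^ k.toNat) ^ (D₂ - j)) = 0 →
        ∀ τ : ℍ, ∑ i : Fin (D₁ + 1), ∑ j : Fin (D₂ + 1),
          c i j * kleinJ τ ^ (i : ℕ) *
            ((∑' n : ℕ, b n * Function.Periodic.qParam 1 (τ : ℂ) ^ n) ^ 12 /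
              ModularForm.discriminant τ ^ k) ^ (j : ℕ) = 0 := by
  obtain ⟨hnice, hsum, hqexp⟩ := qSeries_nice hb
  have hper : ∀ τ : ℍ,
      (∑' n : ℕ, b n * Function.Periodic.qParam 1 (((1 : ℝ) +ᵥ τ : ℍ) : ℂ) ^ n) =
        ∑' n : ℕ, b n * Function.Periodic.qParam 1 (τ : ℂ) ^ n := fun τ ↦ by
    rw [qParam_vadd_one τ]
  refine ⟨hnice.2.1, hper, hsum, hqexp, mdifferentiable_pow_div_zpow hnice.2.1 k,
    fun τ ↦ by rw [hper τ, discriminant_vadd_one τ], fun t ht0 ht1 ↦ ?_,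
    fun t ht0 ht1 ↦ coeff_bound_of_nice one_pos nice_discriminant t ht0 ht1,
    fun D₁ D₂ c hc τ ↦ transfer k hnice hqexp D₁ D₂ c hc τ⟩
  rw [← qExpansion_pow_of_nice one_pos nice_E₄ 3]
  exact coeff_bound_of_nice one_pos (nice_pow nice_E₄ 3) t ht0 ht1

end Summit.Langlands.Langlands.Theorems.CapacityClassicality
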